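import Summits.Ventures.PercRepro.Night2ThreeTwoNonBad

/-!
# PercRepro — the cell `(3, 2)`: the bad targets above a covering basis are few (night-2, gen 26)

Groundwork for the obstruction cells with `|V| ≤ 10`, continued.  By `bad_target_structure` a bad target `S` above a
covering basis `Q = K ∪ T` is `Q ∪ A` with `A = (S ∖ K) ∖ T` inside the line `cl {u, v}` of a pair `{u, v} ⊆ T`.  So the
bad targets with `|S ∖ K| = s` number at most `Σ_{pairs {u,v} ⊆ T} C(|(cl {u, v} ∩ V) ∖ T|, s − 4)`: binomials in the sizes
of the six lines through two basis points.

* **`card_bad_targets_le`**: the count.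
-/

namespace PercRepro.Shadow

open Finset PerFlat ThmH

variable {α : Type*} [DecidableEq α] {M : Matroid α} [M.Finite]

section BadCount

variable {G : Finset α}

open scoped Classical in
/-- **THE BAD TARGETS ABOVE A COVERING BASIS ARE FEW**: for `Q ∈ shadowAt` with `|Q ∖ K| = 4`, the bad shadow sets
`S ⊇ Q` with `|S ∖ K| = s` number at most `Σ_{p ∈ (Q ∖ K).powersetCard 2} C(|(cl p ∩ V) ∖ (Q ∖ K)|, s − 4)`. -/
theorem card_bad_targets_le (hG : G ∈ flatsQ M (5 + 1)) (hk : kColoops M G = 2)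
    (hs : ∀ e ∈ gr M, ∀ f ∈ gr M, e ≠ f → rkN M {e, f} = 2)
    {Q : Finset α} (hQ : Q ∈ shadowAt M (5 + 2) 5 (Uq M (5 + 2) 5) G) (hQc : (Q \ coloops M G).card = 4) (s : ℕ) :
    ((shadowAt M (5 + 2) 5 (Uq M (5 + 2) 5) G).filter
        (fun S => Q ⊆ S ∧ BadTarget M G S ∧ (S \ coloops M G).card = s)).card ≤
      ∑ p ∈ (Q \ coloops M G).powersetCard 2,
        (((clF M p ∩ (G \ coloops M G)) \ (Q \ coloops M G)).card).choose (s - 4) := by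
  have hKQ : coloops M G ⊆ Q := coloops_subset_of_mem_shadowAt hQ
  set T := Q \ coloops M G with hT
  set 𝒮 := (shadowAt M (5 + 2) 5 (Uq M (5 + 2) 5) G).filter
    (fun S => Q ⊆ S ∧ BadTarget M G S ∧ (S \ coloops M G).card = s) with h𝒮
  set U : Finset (Finset α) := (T.powersetCard 2).biUnion
    (fun p => (((clF M p ∩ (G \ coloops M G)) \ T).powersetCard (s - 4))) with hU
  -- the map `S ↦ (S ∖ K) ∖ T` is injective on the targets and lands in `U`
  have hmaps : ∀ S ∈ 𝒮, (S \ coloops M G) \ T ∈ U := by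
    intro S hS
    rw [h𝒮, Finset.mem_filter] at hS
    obtain ⟨hSsh, hQS, ⟨w, hw, w', hw', hne, hr⟩, hcard⟩ := hS
    obtain ⟨hwQ, hw'Q, hsub⟩ := bad_target_structure hG hk hs hQ hQc hSsh hQS hw hw' hne hr
    rw [hU, Finset.mem_biUnion]
    refine ⟨T \ {w, w'}, ?_, ?_⟩
    · rw [Finset.mem_powersetCard]
      refine ⟨Finset.sdiff_subset, ?_⟩
      have hpair : ({w, w'} : Finset α) ⊆ T := by
        intro a ha
        rw [Finset.mem_insert, Finset.mem_singleton] at ha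
        rcases ha with rfl | rfl
        · exact Finset.mem_sdiff.2 ⟨hwQ, (Finset.mem_sdiff.1 hw).2⟩
        · exact Finset.mem_sdiff.2 ⟨hw'Q, (Finset.mem_sdiff.1 hw').2⟩
      rw [Finset.card_sdiff_of_subset hpair, hQc, Finset.card_pair hne]
    · rw [Finset.mem_powersetCard]
      constructor
      · intro a ha
        rw [Finset.mem_sdiff] at ha
        rw [Finset.mem_sdiff, Finset.mem_inter]
        refine ⟨⟨?_, (Finset.mem_sdiff.1 ha.1).1 |> fun h => Finset.mem_sdiff.2 ⟨subset_G_of_mem_shadowAt hSsh h, (Finset.mem_sdiff.1 ha.1).2⟩⟩, ha.2⟩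
        apply hsub
        rw [Finset.mem_sdiff, Finset.mem_insert, Finset.mem_singleton, not_or]
        refine ⟨ha.1, ?_, ?_⟩
        · rintro rfl; exact ha.2 (Finset.mem_sdiff.2 ⟨hwQ, (Finset.mem_sdiff.1 hw).2⟩)
        · rintro rfl; exact ha.2 (Finset.mem_sdiff.2 ⟨hw'Q, (Finset.mem_sdiff.1 hw').2⟩)
      · have hTS : T ⊆ S \ coloops M G := Finset.sdiff_subset_sdiff hQS (Finset.Subset.refl _)
        rw [Finset.card_sdiff_of_subset hTS, hcard, hQc]
  have hinj : ∀ S ∈ 𝒮, ∀ S' ∈ 𝒮, (S \ coloops M G) \ T = (S' \ coloops M G) \ T → S = S' := by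
    intro S hS S' hS' h
    rw [h𝒮, Finset.mem_filter] at hS hS'
    have e : ∀ X, Q ⊆ X → X = Q ∪ ((X \ coloops M G) \ T) := by
      intro X hQX
      ext a
      simp only [Finset.mem_union, Finset.mem_sdiff, hT]
      constructor
      · intro haX
        by_cases haQ : a ∈ Q
        · exact Or.inl haQ
        · exact Or.inr ⟨⟨haX, fun hK => haQ (hKQ hK)⟩, fun h => haQ h.1⟩
      · rintro (haQ | ⟨⟨haX, -⟩, -⟩)
        · exact hQX haQ
        · exact haX
    rw [e S hS.2.1, e S' hS'.2.1, h]
  calc 𝒮.card ≤ U.card := by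
        apply Finset.card_le_card_of_injOn (fun S => (S \ coloops M G) \ T)
        · intro S hS
          exact hmaps S (Finset.mem_coe.1 hS)
        · intro S hS S' hS' h
          exact hinj S (Finset.mem_coe.1 hS) S' (Finset.mem_coe.1 hS') h
    _ ≤ ∑ p ∈ T.powersetCard 2, (((clF M p ∩ (G \ coloops M G)) \ T).powersetCard (s - 4)).card :=
        Finset.card_biUnion_le
    _ = ∑ p ∈ T.powersetCard 2, (((clF M p ∩ (G \ coloops M G)) \ T).card).choose (s - 4) := by
        apply Finset.sum_congr rfl
        intro p _
        rw [Finset.card_powersetCard]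

end BadCount

end PercRepro.Shadow
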